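import Summits.Ventures.PercRepro.C025ProfileThinRowA

/-!
# THE ROW `(q, q+1)` IN THE THIN REGIME — part B: the index sets of a rank-`(q+1)` set and their bounds (night-3 g13)
`proofs/NIGHT3-G13-LIFT.md` §4. For a rank-`(q+1)` set `S` the simple rule's load is carried by
* `D₁(S)` — the demanding coloops `x` of `S` (`S ∖ x` a demanding rank-`q` set, `x ∉ cl(S ∖ x)`), each paying `1`, and
* `D₂(S)` — the pairs `(x, y)` with `B := S ∖ {x, y}` a SHORT demanding rank-`q` set whose closure is `S ∖ x`, each paying `1/|F_B|`
  with `|F_B| = |E ∖ S| + 1` (`card_outer_eq_of_mem_D2`).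
Both lie over the coloops of `S` (`D1_subset_col`, `D2_subset_product`), `D₂ ≠ ∅` forces `|S| = q + 2` and `D₁ ≠ ∅` forces
`|S| ≤ q + 2` (thinness), a demanding coloop forces `|E ∖ S| + 1 ≥ q + 1` and a short pair `|E ∖ S| + 1 ≥ q`
(`card_sdiff_of_mem_D1`, `card_sdiff_of_mem_D2`), and in a SIMPLE matroid a rank-`(q+1)` set with `q + 2` points has at least
three non-coloops — the points of its circuit (`card_col_add_three_le`). Part C turns these into (Cap) for `q ≤ 5`.
-/
open scoped Matroid
namespace PercRepro
open Set Finset ThmH Staged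
namespace ThinRow
variable {α : Type} [DecidableEq α] {M : Matroid α} [M.Finite]

/-- If `y ∈ cl(S ∖ y)` then `ρ(S ∖ y) = ρ(S)` (`S ⊆ gr M`). -/
theorem rkN_erase_eq_of_mem_clF_erase {S : Finset α} (hSg : S ⊆ gr M) {y : α} (h : y ∈ clF M (S.erase y)) :
    rkN M (S.erase y) = rkN M S := by
  apply le_antisymm (rkN_mono (Finset.erase_subset _ _))
  have hsub : S ⊆ clF M (S.erase y) := by
    intro z hz
    by_cases hzy : z = y
    · rw [hzy]; exact h
    · exact subset_clF_self ((Finset.erase_subset _ _).trans hSg) (Finset.mem_erase.mpr ⟨hzy, hz⟩)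
  exact rkN_le_of_subset_clF hsub

/-- `|gr M ∖ (S ∖ x)| = |gr M ∖ S| + 1` for `x ∈ S ∩ gr M`. -/
theorem card_sdiff_erase {S : Finset α} {x : α} (hxg : x ∈ gr M) (hxS : x ∈ S) :
    (gr M \ S.erase x).card = (gr M \ S).card + 1 := by
  rw [Finset.sdiff_erase hxg, Finset.card_insert_of_notMem]
  rw [Finset.mem_sdiff]; push Not
  intro _; exact hxS

/-- **The first index set**: a demanding coloop `x ∈ D₁(S)` is a coloop of `S`. -/
theorem D1_subset_col {q : ℕ} {S : Finset α} (hS : S ∈ Shadow.levelSet M (q + 1)) :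
    S.filter (fun x => S.erase x ∈ Profile.Rq M q ∧ q + 1 ≤ crk M (S.erase x) ∧ x ∈ outer M (S.erase x)) ⊆
      S.filter (fun x => rkN M (S.erase x) + 1 = rkN M S) := by
  intro x hx
  rw [Finset.mem_filter] at hx ⊢
  refine ⟨hx.1, ?_⟩
  rw [Profile.mem_Rq] at hx
  rw [Profile.mem_levelSet] at hS
  rw [rkN_eq_iff.mpr hx.2.1.2, rkN_eq_iff.mpr hS.2]

/-- A demanding coloop `x ∈ D₁(S)` forces `|S| ≤ q + 2` (thinness) and `q + 1 ≤ |gr M ∖ S| + 1`. -/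
theorem card_of_mem_D1 {q : ℕ} (hthin : ∀ X ⊆ gr M, rkN M X = q → X.card ≤ q + 1) {S : Finset α}
    (hS : S ∈ Shadow.levelSet M (q + 1)) {x : α}
    (hx : x ∈ S.filter (fun x => S.erase x ∈ Profile.Rq M q ∧ q + 1 ≤ crk M (S.erase x) ∧ x ∈ outer M (S.erase x))) :
    S.card ≤ q + 2 ∧ q + 1 ≤ (gr M \ S).card + 1 := by
  rw [Finset.mem_filter] at hx
  rw [Profile.mem_levelSet] at hS
  obtain ⟨hxS, hRq, hd, _⟩ := hx
  rw [Profile.mem_Rq] at hRq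
  have h1 : (S.erase x).card ≤ q + 1 := hthin _ hRq.1 (rkN_eq_iff.mpr hRq.2)
  rw [Finset.card_erase_of_mem hxS] at h1
  have hpos : 0 < S.card := Finset.card_pos.mpr ⟨x, hxS⟩
  refine ⟨by omega, ?_⟩
  have h2 : crk M (S.erase x) ≤ (gr M \ S.erase x).card := rkN_le_card _
  rw [card_sdiff_erase (hS.1 hxS) hxS] at h2
  omega

/-- **The second index set**: for `(x, y) ∈ D₂(S)` with `B = S ∖ {x, y}`: `cl B = S ∖ x`, `|F_B| = |gr M ∖ S| + 1`, `|S| = q + 2`,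
`q ≤ |gr M ∖ S| + 1`, `x` is a coloop of `S` and `y` is not. -/
theorem mem_D2_facts {q : ℕ} (hthin : ∀ X ⊆ gr M, rkN M X = q → X.card ≤ q + 1) {S : Finset α}
    (hS : S ∈ Shadow.levelSet M (q + 1)) {xy : α × α}
    (hxy : xy ∈ (S ×ˢ S).filter (fun xy => xy.1 ≠ xy.2 ∧ (S.erase xy.1).erase xy.2 ∈ Profile.Rq M q ∧
      q + 1 ≤ crk M ((S.erase xy.1).erase xy.2) ∧
      crk M ((S.erase xy.1).erase xy.2) = (outer M ((S.erase xy.1).erase xy.2)).card + 1 ∧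
      xy.1 ∈ outer M ((S.erase xy.1).erase xy.2) ∧ S = insert xy.1 (clF M ((S.erase xy.1).erase xy.2)))) :
    clF M ((S.erase xy.1).erase xy.2) = S.erase xy.1 ∧
    (outer M ((S.erase xy.1).erase xy.2)).card = (gr M \ S).card + 1 ∧ S.card = q + 2 ∧ q ≤ (gr M \ S).card + 1 ∧
    rkN M (S.erase xy.1) + 1 = rkN M S ∧ ¬ (rkN M (S.erase xy.2) + 1 = rkN M S) := by
  rw [Finset.mem_filter, Finset.mem_product] at hxy
  obtain ⟨⟨hxS, hyS⟩, hne, hRq, hd, hshort, hxo, hSeq⟩ := hxy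
  rw [Profile.mem_levelSet] at hS
  set B := (S.erase xy.1).erase xy.2 with hB
  rw [Profile.mem_Rq] at hRq
  have hBq : rkN M B = q := rkN_eq_iff.mpr hRq.2
  have hSq : rkN M S = q + 1 := rkN_eq_iff.mpr hS.2
  have hxcl : xy.1 ∉ clF M B := (mem_outer.mp hxo).2
  have hcl : clF M B = S.erase xy.1 := by
    rw [hSeq, Finset.erase_insert hxcl]
  have hout : outer M B = gr M \ S.erase xy.1 := by
    unfold outer; rw [hcl]
  have hcard_out : (outer M B).card = (gr M \ S).card + 1 := by
    rw [hout, card_sdiff_erase (hS.1 hxS) hxS]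
  -- |S| = q + 2: `cl B` has `q + 1` points (at most by thinness, at least `|B| + 1 ≥ q + 1` since `B` is short)
  have hBg : B ⊆ gr M := hRq.1
  have hcl_le : (clF M B).card ≤ q + 1 := hthin _ (clF_subset_gr B) (by rw [rkN_clF, hBq])
  have hinner : (inner M B).Nonempty := by
    rw [Finset.nonempty_iff_ne_empty]
    intro hE
    have h1 := crk_le_fB_add_card_inner hBg
    rw [hE, Finset.card_empty] at h1
    have h2 : fB M B ≤ (outer M B).card := rkN_le_card _
    omega
  have hcl_ge : B.card + 1 ≤ (clF M B).card := by
    have h3 : (inner M B).card = (clF M B).card - B.card := Finset.card_sdiff_of_subset (subset_clF_self hBg)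
    have h4 : 0 < (inner M B).card := Finset.card_pos.mpr hinner
    have h5 : B.card ≤ (clF M B).card := Finset.card_le_card (subset_clF_self hBg)
    omega
  have hBcard : q ≤ B.card := hBq ▸ rkN_le_card B
  have hcl_card : (clF M B).card = S.card - 1 := by
    rw [hcl, Finset.card_erase_of_mem hxS]
  have hSpos : 0 < S.card := Finset.card_pos.mpr ⟨xy.1, hxS⟩
  have hScard : S.card = q + 2 := by omega
  -- `q ≤ |gr M ∖ S| + 1` from the demand
  have hq : q ≤ (gr M \ S).card + 1 := by omega
  -- `x` is a coloop of `S`, `y` is not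
  have hxcol : rkN M (S.erase xy.1) + 1 = rkN M S := by
    rw [← hcl, rkN_clF, hBq, hSq]
  have hycol : ¬ (rkN M (S.erase xy.2) + 1 = rkN M S) := by
    intro hcol
    have hsub : insert xy.1 B ⊆ S.erase xy.2 := by
      intro z hz
      rw [Finset.mem_insert] at hz
      rcases hz with rfl | hz
      · exact Finset.mem_erase.mpr ⟨hne, hxS⟩
      · have h1 := Finset.mem_erase.mp hz
        exact Finset.mem_erase.mpr ⟨h1.1, Finset.mem_of_mem_erase h1.2⟩
    have h1 : rkN M (insert xy.1 B) ≤ rkN M (S.erase xy.2) := rkN_mono hsub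
    rw [rkN_insert_of_mem_outer hxo, hBq] at h1
    omega
  exact ⟨hcl, hcard_out, hScard, hq, hxcol, hycol⟩

/-- **Three non-coloops**: in a simple matroid a rank-`(q+1)` set `S` with `q + 2` points has a circuit, of size `≥ 3`, whose points are
not coloops of `S`: `#col S + 3 ≤ |S|`. -/
theorem card_col_add_three_le (hsimple : ∀ T ⊆ M.E, T.encard ≤ 2 → M.Indep T) {q : ℕ} {S : Finset α}
    (hS : S ∈ Shadow.levelSet M (q + 1)) (hcard : S.card = q + 2) :
    (S.filter (fun x => rkN M (S.erase x) + 1 = rkN M S)).card + 3 ≤ S.card := by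
  rw [Profile.mem_levelSet] at hS
  obtain ⟨hSg, hSr⟩ := hS
  have hSE : (S : Set α) ⊆ M.E := by rw [← coe_gr]; exact_mod_cast hSg
  have hdep : M.Dep (S : Set α) := by
    rw [Matroid.dep_iff]
    refine ⟨fun hind => ?_, hSE⟩
    have h1 := hind.eRk_eq_encard
    rw [hSr, Set.encard_coe_eq_coe_finsetCard, hcard] at h1
    have h2 : q + 1 = q + 2 := by exact_mod_cast h1
    omega
  obtain ⟨C, hCS, hC⟩ := hdep.exists_isCircuit_subset
  have hC3 : 3 ≤ C.encard := by
    rcases le_or_gt C.encard 2 with h2 | h3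
    · exact absurd (hsimple C hC.subset_ground h2) hC.dep.not_indep
    · have h4 : (2 : ℕ∞) + 1 ≤ C.encard := (ENat.add_one_le_iff (by norm_num)).mpr h3
      norm_num at h4
      exact h4
  have hCfin : C.Finite := S.finite_toSet.subset hCS
  set Cf := hCfin.toFinset with hCf
  have hCfS : Cf ⊆ S := by rw [hCf, Set.Finite.toFinset_subset]; exact hCS
  have hCfcard : 3 ≤ Cf.card := by
    have h1 : ((Cf : Set α)).encard = Cf.card := Set.encard_coe_eq_coe_finsetCard Cf
    rw [hCf, Set.Finite.coe_toFinset] at h1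
    rw [h1] at hC3
    exact_mod_cast hC3
  -- the points of the circuit are not coloops of `S`
  have hCfcol : Cf ⊆ S \ S.filter (fun x => rkN M (S.erase x) + 1 = rkN M S) := by
    intro y hy
    have hyC : y ∈ C := by rw [hCf, Set.Finite.mem_toFinset] at hy; exact hy
    have hyS : y ∈ S := hCS hyC
    rw [Finset.mem_sdiff, Finset.mem_filter]
    refine ⟨hyS, fun hcol => ?_⟩
    have hycl : y ∈ clF M (S.erase y) := by
      have h1 : y ∈ M.closure (C \ {y}) := hC.mem_closure_sdiff_singleton_of_mem hyC
      have h2 : C \ {y} ⊆ ((S.erase y : Finset α) : Set α) := by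
        rw [Finset.coe_erase]
        exact Set.sdiff_subset_sdiff_left hCS
      have h3 : y ∈ M.closure ((S.erase y : Finset α) : Set α) := M.closure_subset_closure h2 h1
      rw [← coe_clF] at h3
      exact_mod_cast h3
    have h4 := rkN_erase_eq_of_mem_clF_erase hSg hycl
    omega
  have h5 : Cf.card ≤ (S \ S.filter (fun x => rkN M (S.erase x) + 1 = rkN M S)).card := Finset.card_le_card hCfcol
  rw [Finset.card_sdiff_of_subset (Finset.filter_subset _ _)] at h5
  have h6 : (S.filter (fun x => rkN M (S.erase x) + 1 = rkN M S)).card ≤ S.card :=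
    Finset.card_le_card (Finset.filter_subset _ _)
  omega

/-- **The `e = 1` load of `S` is at most `#D₁(S)`**: the rank-`q` subsets `B ⊆ S` with `S = B ∪ {x}`, `x ∈ F_B`, `B` demanding, are the
sets `S ∖ x`, `x ∈ D₁(S)`. -/
theorem sum_w1_le_card_D1 (q : ℕ) {S : Finset α} :
    ∑ B ∈ (Profile.Rq M q).filter (fun B => B ⊆ S),
      (if q + 1 ≤ crk M B ∧ ∃ x ∈ outer M B, S = insert x B then (1 : ℚ) else 0) ≤
    ((S.filter (fun x => S.erase x ∈ Profile.Rq M q ∧ q + 1 ≤ crk M (S.erase x) ∧ x ∈ outer M (S.erase x))).card : ℚ) := by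
  rw [Finset.sum_boole]
  have hsub : ((Profile.Rq M q).filter (fun B => B ⊆ S)).filter
      (fun B => q + 1 ≤ crk M B ∧ ∃ x ∈ outer M B, S = insert x B) ⊆
      (S.filter (fun x => S.erase x ∈ Profile.Rq M q ∧ q + 1 ≤ crk M (S.erase x) ∧ x ∈ outer M (S.erase x))).image
        (fun x => S.erase x) := by
    intro B hB
    rw [Finset.mem_filter, Finset.mem_filter] at hB
    obtain ⟨⟨hRq, _⟩, hd, x, hx, hSeq⟩ := hB
    have hBg : B ⊆ gr M := (Profile.mem_Rq.mp hRq).1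
    have hxB : x ∉ B := notMem_of_mem_outer hBg hx
    have hBeq : S.erase x = B := by rw [hSeq, Finset.erase_insert hxB]
    rw [Finset.mem_image]
    refine ⟨x, ?_, hBeq⟩
    rw [Finset.mem_filter, hBeq]
    exact ⟨hSeq ▸ Finset.mem_insert_self x B, hRq, hd, hx⟩
  have h1 := Finset.card_le_card hsub
  have h2 := Finset.card_image_le (s := S.filter (fun x => S.erase x ∈ Profile.Rq M q ∧ q + 1 ≤ crk M (S.erase x) ∧
    x ∈ outer M (S.erase x))) (f := fun x => S.erase x)
  exact_mod_cast h1.trans h2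

/-- **The short load of `S` is at most `#D₂(S) / (|gr M ∖ S| + 1)`** (thin regime). -/
theorem sum_w2_le_card_D2 (q : ℕ) (hthin : ∀ X ⊆ gr M, rkN M X = q → X.card ≤ q + 1) {S : Finset α}
    (hS : S ∈ Shadow.levelSet M (q + 1)) :
    ∑ B ∈ (Profile.Rq M q).filter (fun B => B ⊆ S),
      (if q + 1 ≤ crk M B ∧ crk M B = (outer M B).card + 1 ∧ ∃ x ∈ outer M B, S = insert x (clF M B) then
        1 / ((outer M B).card : ℚ) else 0) ≤
    (((S ×ˢ S).filter (fun xy => xy.1 ≠ xy.2 ∧ (S.erase xy.1).erase xy.2 ∈ Profile.Rq M q ∧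
      q + 1 ≤ crk M ((S.erase xy.1).erase xy.2) ∧
      crk M ((S.erase xy.1).erase xy.2) = (outer M ((S.erase xy.1).erase xy.2)).card + 1 ∧
      xy.1 ∈ outer M ((S.erase xy.1).erase xy.2) ∧ S = insert xy.1 (clF M ((S.erase xy.1).erase xy.2)))).card : ℚ) /
      (((gr M \ S).card : ℚ) + 1) := by
  set D2 := (S ×ˢ S).filter (fun xy => xy.1 ≠ xy.2 ∧ (S.erase xy.1).erase xy.2 ∈ Profile.Rq M q ∧
      q + 1 ≤ crk M ((S.erase xy.1).erase xy.2) ∧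
      crk M ((S.erase xy.1).erase xy.2) = (outer M ((S.erase xy.1).erase xy.2)).card + 1 ∧
      xy.1 ∈ outer M ((S.erase xy.1).erase xy.2) ∧ S = insert xy.1 (clF M ((S.erase xy.1).erase xy.2))) with hD2
  rw [← Finset.sum_filter]
  set P2 := ((Profile.Rq M q).filter (fun B => B ⊆ S)).filter
    (fun B => q + 1 ≤ crk M B ∧ crk M B = (outer M B).card + 1 ∧ ∃ x ∈ outer M B, S = insert x (clF M B)) with hP2
  -- every member of `P2` is `S ∖ {x, y}` for a pair `(x, y) ∈ D₂`, and has `|F_B| = |gr M ∖ S| + 1`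
  have hmem : ∀ B ∈ P2, (outer M B).card = (gr M \ S).card + 1 ∧ ∃ xy ∈ D2, (S.erase xy.1).erase xy.2 = B := by
    intro B hB
    rw [hP2, Finset.mem_filter, Finset.mem_filter] at hB
    obtain ⟨⟨hRq, _⟩, hd, hshort, x, hx, hSeq⟩ := hB
    rw [Profile.mem_levelSet] at hS
    have hBg : B ⊆ gr M := (Profile.mem_Rq.mp hRq).1
    have hBq : rkN M B = q := rkN_eq_iff.mpr (Profile.mem_Rq.mp hRq).2
    have hxcl : x ∉ clF M B := (mem_outer.mp hx).2
    have hcl : clF M B = S.erase x := by rw [hSeq, Finset.erase_insert hxcl]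
    have hxS : x ∈ S := hSeq ▸ Finset.mem_insert_self x _
    -- the inner point `y`
    have hinner : (inner M B).Nonempty := by
      rw [Finset.nonempty_iff_ne_empty]
      intro hE
      have h1 := crk_le_fB_add_card_inner hBg
      rw [hE, Finset.card_empty] at h1
      have h2 : fB M B ≤ (outer M B).card := rkN_le_card _
      omega
    obtain ⟨y, hy⟩ := hinner
    have hy' := mem_inner.mp hy
    have hin1 : (inner M B).card ≤ 1 := card_inner_le_one hthin hBg hBq
    have hinner_eq : inner M B = {y} := by
      apply Finset.eq_singleton_iff_unique_mem.mpr
      refine ⟨hy, fun z hz => ?_⟩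
      by_contra hzy
      have h2 : 2 ≤ (inner M B).card := by
        have : ({z, y} : Finset α) ⊆ inner M B := by
          intro w hw
          rw [Finset.mem_insert, Finset.mem_singleton] at hw
          rcases hw with rfl | rfl
          · exact hz
          · exact hy
        have h3 := Finset.card_le_card this
        rw [Finset.card_pair hzy] at h3
        exact h3
      omega
    have hBeq : (S.erase x).erase y = B := by
      rw [← hcl]
      apply Finset.ext
      intro z
      rw [Finset.mem_erase]
      constructor
      · rintro ⟨hzy, hz⟩
        by_contra hzB
        have : z ∈ inner M B := mem_inner.mpr ⟨hz, hzB⟩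
        rw [hinner_eq, Finset.mem_singleton] at this
        exact hzy this
      · intro hz
        exact ⟨fun h => hy'.2 (h ▸ hz), subset_clF_self hBg hz⟩
    have hyS : y ∈ S := by
      have : y ∈ clF M B := hy'.1
      rw [hcl] at this
      exact Finset.mem_of_mem_erase this
    have hne : x ≠ y := by
      intro h
      have : y ∈ clF M B := hy'.1
      rw [← h] at this
      exact hxcl this
    refine ⟨?_, ⟨(x, y), ?_, hBeq⟩⟩
    · unfold outer
      rw [hcl, card_sdiff_erase (hS.1 hxS) hxS]
    · rw [hD2, Finset.mem_filter, Finset.mem_product]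
      refine ⟨⟨hxS, hyS⟩, hne, ?_, ?_, ?_, ?_, ?_⟩ <;> simp only [hBeq]
      · exact hRq
      · exact hd
      · exact hshort
      · exact hx
      · exact hSeq
  have hconst : ∀ B ∈ P2, (1 : ℚ) / ((outer M B).card : ℚ) = 1 / (((gr M \ S).card : ℚ) + 1) := by
    intro B hB
    rw [(hmem B hB).1]
    push_cast
    rfl
  rw [Finset.sum_congr rfl hconst, Finset.sum_const, nsmul_eq_mul]
  have hsub : P2 ⊆ D2.image (fun xy => (S.erase xy.1).erase xy.2) := by
    intro B hB
    obtain ⟨_, xy, hxy, hEq⟩ := hmem B hB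
    rw [Finset.mem_image]
    exact ⟨xy, hxy, hEq⟩
  have h1 : P2.card ≤ D2.card := (Finset.card_le_card hsub).trans Finset.card_image_le
  have h1' : (P2.card : ℚ) ≤ D2.card := by exact_mod_cast h1
  have hpos : (0 : ℚ) < ((gr M \ S).card : ℚ) + 1 := by positivity
  rw [div_eq_mul_one_div (D2.card : ℚ)]
  exact mul_le_mul_of_nonneg_right h1' (by positivity)

end ThinRow
end PercRepro
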